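import Mathlib
import HarnessLib
import HarnessLib.Audit
import Summits.AtomisticToContinuum.Statement
import Literature.MathematicalPhysics.StatisticalMechanics.MiePotential
import Literature.MathematicalPhysics.StatisticalMechanics.BarlowStacking
import Literature.MathematicalPhysics.StatisticalMechanics.LennardJonesClusters
import Literature.Geometry.DiscreteGeometry.KissingPatterns
import Summits.AtomisticToContinuum.Crystallization.Theorems.BrittleRungDescentLadderGroundStates
import HarnessLib.Audit.Status.Attr

/-!
Route: OneCentreSteepnessLadder

DORMANT since 2026-08-22T08:34:53Z (reconciler: no traction for 5.2 d (last activity item-evidence-added at 2026-08-17T02:58:00Z); parked, not closed — `ledger route dormant route-AtomisticToContinuum-OneCentreSteepnessLadder --off` to ) — unstaffed, not closed; items shared with open routes are served there. `ledger route dormant <id> --off` reactivates.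

# Route OneCentreSteepnessLadder — one-centre domination with one local transfer on the (2q,q)
steepness ladder, local Fejes Tóth as first crux, LJ at q = 6

X ("it suffices to show") = COERCIVE ONE-CENTRE DOMINATION FOR LENNARD-JONES (card
steepness-ladder-one-centre, its (OC_q) at the
summit value q = 6, truncated and transfer-inclusive). Write V_q = miePotential q = r^{-2q}/(2q) −
r^{-q}/q (V₆ = lennardJones,
`miePotential_six`) and φ_q = 2r^{-q} − r^{-2q} = −2q·V_q, so that E = −(1/(4q)) Σ_i Φ(x_i) with the
one-centre functional
Φ(x) = Σ_{y≠x} φ_q(|x−y|) (an identity). X: there are δ > 0 separating all LJ ground states and an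
hcp scale (a, h) with
2/3 < h/a < 5/6 such that for every η a gain γ(η) > 0, and for every ε, R₀ a radius R ≥ R₀ and ONE
local antisymmetric range-R
transfer rule g, give Φ^{≤R}(x) + T_g(x) ≤ Φ_hcp(a,h) + ε at EVERY centre x of EVERY δ-separated S ⊂
ℝ³, improved by γ(η) whenever
the closed (5a/3)-neighbourhood of x is not η-matched (both ways, up to a linear isometry) to the
hcp(a,h) site environment. Given X,
three q-uniform support lemmas (zero defect density, hull exactification, energy limit) instantiated
at q = 6 give `Crystallization`;
the conversion is the proved theorem `closes` (glue.lean). The route's ENGINE and measurable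
deliverable is the same inequality on the
ladder q ≥ q₀ (crux LadderDomination), where shell weights 1 : 2^{−q/2} : (8/3)^{−q/2} : 3^{−q/2}
decouple and the only geometric
input beyond the PROVED kissing number (`musin2006_kissing_three_holds`) is local Fejes Tóth at η =
0 (crux LocalTwelveRigidity).
Lean: `OneCentreDominationLJ`

## Assembly
The deciding theorem is a few lines of logic (sorry-free in Sketch.lean, certified natively): unpack
X into (δ, a, h), the window, LJ
separation and coercive domination at exponent 6; rewrite `miePotential_six : miePotential 6 =
lennardJones` to read separation over
V₆ and to obtain existence of V₆ ground states from the PROVED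
`LennardJonesGroundStatesExist_holds`; ZeroDensityOfDefects at q = 6
gives zero density of η-defective centres for every η; ExactificationCascade at q = 6 gives
IsCrystallizing; DominationEnergyLimit at
q = 6 gives HasPeriodicGroundStateEnergy; rewrite back and pair: `Crystallization`. The rung
composes the same way (RungAssembly ⇒ MieRung).

Rationale: WHY THIS LINE. Every crystallization theorem for realistic potentials is a narrow-well theorem
(HeitmannRadin1980, Theil2006, ELi2008 in d = 2;
FlatleyTheil2015 in d = 3 only WITH a three-body term, arXiv:1407.0692 Thm 1.1), and
`LocalizedPotentialsExcludeLennardJones`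
(`not_isLocalizedPair_miePotential`, p < 8) shows one such step cannot reach (12,6); this line makes
narrowness the family's own
exponent q, asks for a rung theorem at q ≥ q₀ (MieRung, shared with route BrittleRungDescent) and
states the LJ end X in the same
currency. The engine is a POINTWISE bound on one particle's view of the world — the 3-D
Heitmann–Radin count made soft — corrected by
ONE local antisymmetric transfer in the manner of Hales's local-annulus-inequality architecture
(HalesDSP2012 Lemma 6.95, Hales2012
Lemma 1), imported from discrete geometry together with the PROVED kissing number (Musin2005, tree
`musin2006_kissing_three_holds`)
and the PROVED layer propagation (`HalesDSP_layerPackings_holds`); the soft step is Radin's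
ground-state hull (Radin1991) made exact by
compactness instead of any robust-rigidity-with-rate statement. New at this generation (planner
computation calc/deephole.py): a
12-point kissing code with an EMPTY CAP of radius 45.7° exists, i.e. a complete first shell can host
a second-shell site at
r = 1.3968 < √2, and one such site outweighs hcp's six octahedral sites for q ≳ 145 (leading order)
— so the card's square-hole COUNT
lemma cannot control the second-shell VALUE in the steep tail, and the honest geometric input is
local Fejes Tóth at η = 0 (a centre
and its twelve kissers complete ⇒ fcc/hcp shell: Hales2012 Thm 3 + Lemmas 9–10 with Flyspeck L12),
filed as the FIRST crux because it
is unproved in Lean; versus BrittleRungDescent (same family): no gap hypothesis at positive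
tolerance, no a.e. annulus demand, no
truss/Korn rigidity — deficits of under-coordinated atoms pay, through the transfer, for every
surplus a complete shell can collect.

RANKED CRUXES. #0 OneCentreDominationLJ (target) — X as in § Thesis, at q = 6 over `lennardJones`: ∃
δ a h with 0 < δ, 0 < a, 0 < h, 2a < 3h, 6h < 5a, all LJ ground states δ-separated, and coercive
one-centre domination with one local antisymmetric finite-range transfer against the hcp(a,h) site
value Σ'_{p ∈ hcpStacking a h} φ₆(‖p‖), gain γ(η) at every centre whose closed 5a/3-neighbourhood is
not η-matched to hcp(a,h) (card item S4 at q = 6; the non-coercive part says every finite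
δ-separated cluster has truncated energy per particle ≥ e_hcp − ε with a LOCAL certificate). (why it
might fail: q = 6 is not steep: icosahedral/Frank–Kasper and mildly crammed centres beat
close-packed first shells by 4–8 % and the r⁻⁶ tail decouples only geometrically, so no finite-range
LOCAL rule may collect enough nearby deficit (bare r⁻⁶ sums: Mackay 14.7 > hcp 14.455).)
[FlatleyTheil2015, BlancLewin2015, Stillinger2001, Blanc2004, Xue1997, HalesDSP2012]
#2 LocalTwelveRigidity (crux) — LOCAL FEJES TÓTH AT η = 0 (the unproved geometric input of the
engine, filed first by the plancard rule): if S ⊂ ℝ³ has pairwise distances ≥ 1, x ∈ S, and x as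
well as every point of S at distance ≤ 1 from x has at least twelve points of S at distance exactly
1, then the twelve-shell {v : x + v ∈ S, ‖v‖ = 1} is the image of `fccKissingPattern`
(cuboctahedron) or `hcpKissingPattern` (anticuboctahedron) under a linear isometry. In print:
Flyspeck L12 at x and at each kisser gives Hales's class 𝒱 (shell points pairwise at 1 or ≥ 1.26),
then Hales2012 Thm 3 + Lemmas 9–10 (tree: `flyspeck_L12`, `Hales2012_contactGraphTame` UNPROVED
named facts ⇒ `Hales2012_kissingConfigCongruent`; Lemma 10 and the Lemma-9 LPs are proved in tree) —
restated here so that no unproved fact enters the route's cone. Used with compactness only (q₀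
free): complete = twelve bonds in [1 − 2/q, 1 + 5.3/q]. [difficulty: XL] (why it might fail: True in
print (Hales 2012 via Flyspeck L12 + hypermap classification); the risk is formal SIZE: both inputs
are computer-assisted and unproved in the tree (XL), so the crux may starve the ladder; no L12-free
proof using completeness of the kissers is known (Flatley–Theil Conj. 2.2 territory).) [Hales2012,
HalesFlyspeck2012, HalesDSP2012, FlatleyTheil2015, KusnerKusnerLagariasShlosman2018, Musin2005]
#3 LadderDomination (crux) — THE LADDER ENGINE (card (OC_q), truncated + coercive + one local
transfer): ∃ q₀ ∀ q ≥ q₀ ∃ (a,h) with 2/3 < h/a < 5/6 (the Φ-maximising relaxed hcp scale) such that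
∀η ∃γ ∀ε ∀R₀ ∃R ≥ R₀ ∃ a range-R rule g (g v U = 0 for ‖v‖ > R; antisymmetric on every admissible
S): for every (1 − 2/q)-separated S ⊂ ℝ³ and x ∈ S, Σ_{y∈S, |y−x|≤R} φ_q(|y−x|) + T_g(x) ≤
Φ_hcp(q,a,h) + ε, and ≤ Φ_hcp + ε − γ when the closed 5a/3-neighbourhood of x is not
η-hcp(a,h)-matched. Proof plan, shell by shell: first shell ≤ 12 bonds by the PROVED kissing number
+ compactness (a missing/stretched bond costs O(1)); complete neighbourhoods of radius 1 have
fcc/hcp shells by LocalTwelveRigidity + compactness, hence exactly six octahedral sites at √2·a and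
no deeper site; every surplus of a complete centre near an incomplete atom (extra or deep holes: ≤
6·φ_q(1.085) by Tammes-13 compactness) is paid by a fixed fraction of that atom's O(1) deficit
through g (range 2, ≤ C claimants); third shell: the axial pair at 2h beats the three √3-type sites
of a c-aligned side for q ≥ 19 (Flatley–Theil's selector sign read at η = 0), so hcp is the
pointwise maximum among locally Barlow centres; near the equality case the strain-linear transfer
t(x,y) = −φ′(r) ê·(u_x + u_y) kills first-order terms at the equilibrium lattice and local
octet-truss rigidity makes the localised second-order form negative for 2^{−q/2} ≪ κ_R. [deps:
LocalTwelveRigidity] [difficulty: L] (why it might fail: A (1−2/q)-separated environment (crammed,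
deep-hole, Frank–Kasper) may carry surplus whose compensating deficit lies beyond every fixed range
R; hcp must be the pointwise max among Barlow sites at all orders (leading order needs q ≥ 19); the
near field needs a positive localised phonon form.) [FlatleyTheil2015, Theil2006, HeitmannRadin1980,
HalesDSP2012, Hales2012, MusinTarasov2012, BeterminSamajTravenec2022]
#4 ExactificationCascade (crux) — HULL EXACTIFICATION on the ladder (card item S5 = card
hull-exactification-cascade H1, typed so that no Hales-2012 fact is needed): for q ≥ 4, δ, a, h > 0
with 2a < 3h and 6h < 5a, if all V_q ground states are δ-separated and, for EVERY η > 0, the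
fraction of particles whose closed (5a/3)-neighbourhood is not η-matched (both ways, up to a linear
isometry) to the hcp(a,h) site environment tends to 0 along every ground-state sequence, then
IsCrystallizing (miePotential q) 3. Plan (soft, no energy): δ-separation ⇒ ≤ C R³ particles per
R-ball ⇒ by double counting some particle has no η_k-defect within R_k; translate it to 0; local
compactness of δ-separated sets, compactness of O(3) and η_k → 0 give along a diagonal subsequence a
local limit S∞ ∋ 0 every point of which has its open 5a/3-environment EXACTLY isometric to
hcp(a,h)'s (20 sites: hexagon at a, 3+3 at √(a²/3+h²), 3+3 at √(4a²/3+h²), axial pair at 2h — the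
window keeps exactly these inside 5a/3); local-to-global rigidity: common-neighbour pairs force one
hexagon plane per layer, the ρ₁-sextets force parallel layers at spacing h over holes, the axial
pair forces ABAB (ideal h/a = √(2/3): anticuboctahedra, tree `HalesDSP_layerPackings_holds`) ⇒ S∞ ≅
hcpStacking a h, multiplicity 1, periodic limit = isometric image of hcpPeriodicConfiguration.
[difficulty: M] (why it might fail: Two-way closed-ball matching must pass to exact environments
under local limits, and relaxed-hcp rigidity from 5a/3-environments must hold for all h/a in (2/3,
5/6) incl. the ideal case; a non-periodic δ-separated set with all 5a/3-environments
hcp(a,h)-isometric would refute it (none expected).) [Radin1991, BlancLewin2015, HalesDSP2012,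
LucaFriesecke2016]
#5 LJDominationTwoThirds (crux) — THE LJ END MADE REACHABLE (route-choice repair 2026-08-16):
coercive one-centre domination at exponent 6 over ALL (2/3)-separated S ⊂ ℝ³, i.e. X with the ground
states taken out = LadderDomination's matrix at q = 6 (1 − 2/6 = 2/3). Stronger than X only by
contacts in [2/3, d_LJ) (d_LJ > 0.684 proved, ≈ 0.95 expected): φ₆ < 0 below 0.891, they finance
themselves; the live regime (bonds in [0.89, 1.05], 13–14-fold and ico centres, stackings: γ(η) <
Φ_hcp − Φ_fcc ≈ 2e-3) is X's own. Rank 5: after the ladder. [deps: LadderDomination,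
LocalTwelveRigidity] [difficulty: open-problem] (why it might fail: q = 6 is not steep:
ico/Frank–Kasper and 13–14-fold centres come within 4–8 % in the first shell, a third of Φ_hcp lies
beyond it, hcp beats fcc by only 2e-3, so no finite-range rule may localise the deficit.)
[FlatleyTheil2015, BlancLewin2015, HalesDSP2012, Hales2012, Yuhjtman2015]
#9 ZeroDensityOfDefects (support) — ZERO DENSITY OF DEFECTIVE CENTRES from coercive domination (glue
X / LadderDomination → ExactificationCascade): for q ≥ 4, δ, a, h > 0, δ-separated ground states +
coercive domination at (q, δ, a, h) ⇒ for every η the fraction of η-defective centres → 0 along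
every ground-state sequence. Bookkeeping: E = −(1/(4q)) Σ_i Φ(x_i); Σ_i T_g(x_i) = 0 (antisymmetry,
finite S); 0 ≤ Φ − Φ^{≤R} ≤ ε_R(δ, q) → 0 (shell counting, q > 3, φ_q > 0 beyond R ≥ 1); trial upper
bound E(N) ≤ −N Φ_hcp(a,h)/(4q) + o(N) by finite blocks of hcpStacking a h (V_q ≥ −1/(2q),
`groundStateEnergy_le_of_le`); hence γ(η)·#defective ≤ N(ε + ε_R) + o(N) with ε, R free after γ.
[difficulty: M] [Theil2006, LucaFriesecke2016, BlancLewin2015]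
#9 DominationEnergyLimit (support) — ENERGETIC CONJUNCT from domination (uses only its non-coercive
part; hypothesis kept identical to ZeroDensityOfDefects so that `closes` is pure application): for q
≥ 4, δ, a, h > 0, existence of V_q ground states for all N + δ-separation + domination at (q, δ, a,
h) ⇒ HasPeriodicGroundStateEnergy (miePotential q) 3 with P = hcpPeriodicConfiguration a h. Lower
bound: transfers cancel, Φ ≤ Φ^{≤R} + ε_R ⇒ E(N)/N ≥ −(Φ_hcp + ε + ε_R)/(4q). Upper bound: E(N) ≤ N
e(Q) + o(N) for every periodic Q by blocks (point sets of periodic configurations are uniformly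
discrete; tails summable for q > 3; `PeriodicConfigurationSums`), so e(Q) ≥ lim E(N)/N = −Φ_hcp/(4q)
= e(hcp a h) (the two motif sites are equivalent; the p = 0 term of the tsum is 0) — IsLeast with an
explicit minimiser, no compactness over lattices. [difficulty: M] [BlancLewin2015, Theil2006]
#9 LadderGroundStates (support) — GROUND STATES ON THE LADDER EXIST AND ARE (1 − 2/q)-SEPARATED for
q ≥ q₀ (card item S1; SAME SIGNATURE as item stmt-AtomisticToContinuum-10945 of route
BrittleRungDescent, shared): existence by Blanc–Lewin's binding criterion as in the tree's PROVED
`LennardJonesGroundStatesExist_holds`; separation by the removal inequality (site energies < 0 at a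
ground state; a pair at r ≤ 1 − 2/q costs ≈ (e⁴ − 2e²)/(2q) = 39.8/(2q) against ≤ 15–20 near-unit
neighbours of weight 1/(2q) after an a-priori Xue/Blanc bound, as in
`LennardJonesMinimalDistance_holds`). Consumed by RungAssembly. [difficulty: M] [BlancLewin2015,
Blanc2004, Xue1997]
#9 MieRung (support) — THE RUNG (milestone; the card's headline; SAME SIGNATURE as item
stmt-AtomisticToContinuum-10946 of route BrittleRungDescent, shared): ∃ q₀ ∀ q ≥ q₀,
HasPeriodicGroundStateEnergy (miePotential q) 3 ∧ IsCrystallizing (miePotential q) 3 — both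
Blanc–Lewin conjuncts for the Mie (2q,q) pair potential in ℝ³, the first off-lattice 3-D
crystallization theorem for a pure, smooth, LJ-shaped pair potential (Flatley–Theil without V₃;
conclusion relaxed hcp). Closed here by RungAssembly; a hypothesis of `closes` like every item but
not used by its proof. [difficulty: open-problem] [FlatleyTheil2015, Theil2006, ELi2008,
BeterminSamajTravenec2022, BlancLewin2015, arXiv:2604.19239]
#9 RungAssembly (support) — GLUE FOR THE RUNG: LadderDomination → LadderGroundStates →
ZeroDensityOfDefects → ExactificationCascade → DominationEnergyLimit → MieRung (take q ≥ max(q₀,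
q₀', 4); δ = 1 − 2/q > 0; pure bookkeeping). [difficulty: provable-now] [BlancLewin2015,
FlatleyTheil2015]
#9 TargetAssembly (support) — GLUE FOR THE TARGET: LJDominationTwoThirds → OneCentreDominationLJ (δ
:= 2/3; the separation half of X, LJ ground states (2/3)-separated, is discharged inside the proof
by the PROVED `Yuhjtman2015_minDistance_holds`, Cor. 7, > 0.684); `closes` rev 2 derives X through
it. [difficulty: provable-now] [Yuhjtman2015, BlancLewin2015, Blanc2004]

TWO-LAYER PLAN. Foreseen glued splits (nothing filed now; k ≤ 3, depth 1). LadderDomination ⇐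
FirstShellAndDeficit (kissing cap + compactness; every
incomplete atom carries deficit ≥ 1/2; Tammes-13 compactness bounds any complete centre's surplus by
6·φ_q(1.085)) → CompleteNeighbourhoods
(LocalTwelveRigidity + compactness ⇒ fcc/hcp shells ⇒ six octahedral sites, axial count ≤ 2, hcp
pointwise max among Barlow sites for
q ≥ 19, near-field strain-linear transfer + local octet-truss rigidity) → LadderDomination.
ALTERNATIVE split by regime of q if
LocalTwelveRigidity starves: a Hales-free middle window q₀ ≤ q ≤ q₁ via the card's SQUARE-HOLE lemma
upgraded to a VALUE lemma
(cubocta/anticubocta maximise Σ_holes φ_q(r) over complete kissing shells — certifiable, plausibly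
true only below the deep-hole
crossover q₁) plus its equality case and the PROVED layer propagation; the steep tail q > q₁ keeps
LocalTwelveRigidity.
ExactificationCascade ⇐ ExactLimitExists (diagonal hull limit with exact open-ball environments) →
RelaxedHcpRigidity (h/a ∈ (2/3,5/6))
→ ExactificationCascade. X is reached through TargetAssembly from the top-level crux
LJDominationTwoThirds (its layer of children still free), attacked only after the rung: its first
child is the descent table q ↦ (margin of the pointwise bound, d*(q), deep-hole surplus vs. deficit)
and the first q_c where a finite-range rule provably fails.

KILL CRITERIA. LadderDomination refuted for EVERY q (a family of (1 − 2/q)-separated configurations,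
one per q, whose centres carry surplus that no
finite-range antisymmetric rule can absorb — e.g. surplus spread over a region while all deficits
sit at unbounded distance) closes the
route (`close --reason refuted:LadderDomination`): the one-centre mechanism is dead at every rung.
LadderDomination refuted below some q_c
but proved above: the route has delivered the rung; X is then restated with multi-centre cells (new
decl, pivot) or handed to the
certificate cards (frustration-range-lp-hierarchy / equality-free-certificates). LocalTwelveRigidity
cannot be refuted (Hales 2012); if it
starves, resplit LadderDomination by regime (Two-layer plan) — not a kill. ExactificationCascade
refuted as typed (boundary/matching
pathology): restate (open ball, matching radius), not a kill. X refuted directly (an LJ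
configuration family defeating every finite-range local rule at q = 6): the LJ claim of THIS line
dies (`refuted:OneCentreDominationLJ`), the rung items survive as shared statements;
LJDominationTwoThirds refuted with all contacts ≥ d_LJ (≈ 0.95): the same death; refuted only
through contacts in [2/3, d_LJ) that no LJ ground state realises: MISSTATED — re-add it with
separation 0.684 (still proved for LJ) or the witnessed bound and re-glue TargetAssembly.
LadderGroundStates refuted at the constant 2 (true separation 1 − c/q with c > 2): misstated —
repair with the witnessed c in both
LadderGroundStates and LadderDomination. Crystallization proved by another route moots the LJ end,
not the rung.

NOT DECOMPOSED YET. The explicit rule g (under-coordination deficit sharing at range 2, inter-layer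
shipping of stacking gains, strain-linear near-field
part) and its range R(ε); q₀ and the descent table; the deep-hole extremal problem (max empty cap
θ_max of a 12-point kissing code: 45.7°
found, ≤ 50.95° forced by L12) and the crossover q₁; effective (Tammes-type) slack versions of the
kissing cap and of LocalTwelveRigidity
(only exact statements + compactness are needed for ∃ q₀); the axial-site count as a separate
statement (a two-line count once shells are
fcc/hcp); the trial-state and tail constants (inside the two support lemmas); relaxed-hcp rigidity
(inside ExactificationCascade); the
square-hole VALUE lemma of the alternative window split; everything specific to q = 6 beyond X
(multi-centre cells, certified LP/SDP
duals). All are layer-2 children, filed when a crux closes or a prover proposes a split.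

CHEAPEST FALSIFIER. (1) Done here (calc/deephole.py, exact trigonometry on 12 explicit points): the
empty cap of a kissing code already reaches 45.7° (face-up
icosahedron, top triangle pushed to polar 45.7°, rings at 77.6°/105.7°, bottom triangle at 144.74°;
min separation exactly 60°), so a
complete shell admits a second-shell site at 1.3968 < √2; a full 24-dof optimisation (kit, minutes)
gives θ_max ∈ [45.7°, 50.95°]
and hence q₁ (θ_max ≥ 50.95° would contradict L12). (2) The card's basin-hopping test, still not run
by anyone: maximise
Σ_{|y−x|≤3} φ_q(|y−x|) over (1 − 2/q)-separated clusters of ≤ 60 points around a centre for q = 40,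
24, 12, then 6, against Φ_hcp(q)
PLUS the total deficit available within R = 2; one centre beating that kills LadderDomination at
that q (card's uncertified numbers:
Φ_hcp(12) = 12.259 vs Mackay 12.11, anti-Mackay ≤ 12.18; at q = 6 hcp 15.83 vs Mackay 14.95 at
uniform scale; cramming untested).
(3) Lookup done: zbMATH "thirteen spheres problem" (Leech, Anstreicher, Musin–Tarasov, Fejes
Tóth–Heppes, Maehara) — no printed θ_max
for 60°-codes; Tammes-13 (57.1367°) only gives r ≥ 1.085 for a thirteenth near neighbour.

NUMBERS. φ_q(r) = 2r^{−q} − r^{−2q}, V_q = −φ_q/(2q), |V_q(1)| = 1/(2q). Ideal hcp shells (a = 1):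
12 at 1, 6 at √2, 2 at 2h = √(8/3) = 1.633,
18 at √3, 12 at √(11/3) = 1.915, 6 at 2; relaxed (a,h), t = h/a: hexagon at 1, triples at √(1/3+t²)
and √(4/3+t²), axial pair at 2t —
all inside 5/3 with the √3-type shells outside exactly for t ∈ (2/3, 5/6); ideal t = 0.8165, LJ
relaxed t ≈ 0.8164 (c/a − ideal ≈
−1.4e−4, route BrittleRungDescent's lattice sums). Second shell of hcp ≈ 12·2^{−q/2} vs ONE deep
hole 2·1.3968^{−q}: ratio 0.19 (q=12),
0.22 (24), 0.27 (40), 0.58 (100), 1.0 (145), 2.0 (200). Empty cap of a kissing code: 45°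
(cubocta/anticubocta squares; also a triangle
at 45° exists), ≥ 45.7° (this session), < 50.95° (L12: nothing within 1.26 of a twelve-kissed
centre), < 57.14° (Tammes 13, PROVED-able
by compactness from k(3) = 12 only qualitatively). Axial selector: 2φ_q(1.633) > 6φ_q(1.732) iff q >
18.65. One-centre values (card,
uncertified, cutoff 2.1 d_nn, optimal uniform scale): (24,12): Φ_hcp 12.259, Φ_fcc 12.258, Mackay
12.11, anti-Mackay 12.13–12.18;
(18,9): 12.92 vs 12.6–12.8; (12,6): hcp 15.83, fcc 15.76, Mackay 14.95. Separation: δ_q = 1 − 2/q,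
pair cost at δ_q ≈ 39.8 well depths
(q → ∞); LJ tree value δ = 1/3. Items at open: 10 (1 target, 3 cruxes, 5 support, 1 assembly);
shared signatures: 2 (10945, 10946). Rev 2 (2026-08-16): 12 items, 4 cruxes (gate top-level count
15/15). φ₆ < 0 below 0.891: φ₆(2/3) = −106.9, φ₆(0.8) = −6.9, φ₆(0.9) = 0.22, φ₆(0.95) = 0.87;
proved LJ separation 0.684; Φ_hcp = 14.4549²/12.1323 = 17.222 vs Φ_fcc 17.220, first shell (a =
0.971) 11.6.

DEFINITION REQUESTS. None needed to elaborate: `miePotential` (+ `miePotential_six`), `hcpStacking`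
/ `hcpPeriodicConfiguration` (BarlowStacking),
`fccKissingPattern` / `hcpKissingPattern` (KissingPatterns), `IsGroundState` /
`HasPeriodicGroundStateEnergy` / `IsCrystallizing` /
`lennardJones` (Crystallization), `LennardJonesGroundStatesExist_holds` (LennardJonesClusters,
PROVED) all exist (lean check of
Sketch.lean rc 0). Nice-to-have later (not filed): `oneCentreSum q S R x`, `hcpSiteValue q a h`,
`IsLocalTransferRule R g` as defs under
Summits/AtomisticToContinuum/Crystallization/Theorems to shorten the four items that inline the
domination template.

Novelty: Searches (2026-08-15, this session): `lit frontier AtomisticToContinuum --since 2022` (30 rows;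
crystallization rows only arXiv:2604.19239
polycrystals and arXiv:2407.20762 plane/arbitrary norm — nothing 3-D off-lattice); `lit search
--source crossref "crystallization three
dimensions Lennard-Jones pair potential" --year-from 2023` (13, none relevant;
doi:10.1016/j.na.2022.113046 is 1-D); `lit search --source
zbmath "thirteen spheres problem"` (8: doi:10.2307/3610264, doi:10.1007/s00454-003-0819-2,
doi:10.1007/s00454-011-9392-2,
doi:10.4153/cjm-1967-100-x, Maehara 2001/2007 — no covering-radius/deep-hole value for kissing
codes); `lit search --hybrid "twelve unit
spheres touching central sphere room for thirteenth sphere"` (12 book hits: Conway–Sloane,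
Croft–Falconer–Guy D12 p.136, Coxeter — no
lemma); `lit galaxy search "thirteenth sphere of radius" | "twelve spheres problem" --star all`
(0/0, substring corpus noise); openalex/arxiv
rate-limited (logged); plus the card's two audited search passes (refuter-3, refuter-14: FT citation
cone 22/65, Kreutz–Ziereis p.2).
Nearest prior art found: FlatleyTheil2015 (arXiv:1407.0692: d = 3 narrow well WITH V₃; selector sign
at √(8/3), √3; Conj. 2.2),
Theil2006 / ELi2008 (d = 2 one-step narrow-well scheme), Hales2012 (arXiv:1209.6043: L12 + local
classification — the content of
LocalTwelveRigidity) with HalesDSP2012 Lemma 6.95 (one-centre annulus inequality, for density),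
HeitmannRadin1980 (one-centre count,
d = 2), BeterminSamajTravene  [refs: 10.1016/j.na.2022.113046, 10.2307/3610264, 10.1007/s00454-003-0819-2, 10.1007/s00454-011-9392-2, 10.4153/cjm-1967-100-x, 2604.19239, 2407.20762, 1407.0692, 1209.6043, 2107.14020, doi:10.1016/j.na.2022.113046, doi:10.2307/3610264, doi:10.1007/s00454-003-0819-2, doi:10.1007/s00454-011-9392-2, doi:10.4153/cjm-1967-100-x, FlatleyTheil2015, Theil2006, ELi2008, Hales2012, HalesDSP2012, HeitmannRadin1980]

Barriers (technique_class: narrow-well one-centre-bound local-transfer exact-hull): - technique_class: narrow-well one-centre-bound local-transfer exact-hull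
- Literature.Barriers.AtomisticToContinuum.LocalizedPotentialsExcludeLennardJones: APPLIES in spirit
— every rung q ≥ q₀ is a narrow-well theorem and `not_isLocalizedPair_miePotential` puts (2q,q), q <
8, outside Flatley–Theil's class; evaded formally (nothing instantiated from Theil2006.IsAdmissible
/ IsLocalizedPair: the exponent is the parameter and LadderDomination is re-proved per q) and
conceded substantively: the summit needs X at q = 6, whose why-might-fail is this barrier's content;
the bet is that a finite-range rule survives to q_c ≤ 6 or names q_c.
- Literature.Barriers.AtomisticToContinuum.TetrahedralFrustration: APPLIES — a one-centre bound is a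
single-cell bound and pure single-cell density bounds fail in ℝ³ (Rogers 0.7797, dodecahedral
0.755); evaded on the ladder because the scored quantity is ENERGY with an exponentially narrow well
(a regular-tetrahedral/icosahedral environment gains nothing in the first shell and loses the
octahedral second shell) plus ONE transfer fed by O(1) under-coordination deficits that
LocalTwelveRigidity guarantees within range 1 of any non-fcc/hcp complete shell; at q = 6 it bites
and is the declared risk of X.
- Literature.Barriers.AtomisticToContinuum.IcosahedralClusters: APPLIES to any first-shell-only
inequality (ico shells win ≈4 % at q = 6, ≈8.4 % for 13-atom clusters); evaded by scoring two to
three shells (icosahedral shells host no site below 1.59;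

History (route lifecycle, newest last):
- 2026-08-16T03:32:11Z · rev 4: dropped OneCentreDominationThird, LJGroundStatesThirdSeparated, DominationLJGlue — consolidate a concurrent duplicate repair: rbadge-…-c7ae732e (03:15Z) and rchoice-…-077b8449 (03:26Z, this seat) both decomposed X as Sep(δ) ∧ Dom(δ) → OneCentr (planner-rchoice-AtomisticToContinuum-OneCentre-077b8449-0)
- 2026-08-16T03:47:40Z · AUTO-CRUX (backfill): OneCentreDominationLJ — hypotheses of the deciding theorem that nothing in the route derives are cruxes (operator:999:586464)
- 2026-08-22T08:34:53Z · DORMANT — reconciler: no traction for 5.2 d (last activity item-evidence-added at 2026-08-17T02:58:00Z); parked, not closed — `ledger route dormant route-AtomisticToConti (operator:999:1458405)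

sub-problem: Crystallization · status: dormant · opened planner-plancard-AtomisticToContinuum-Crystal-0ba36546-g2-0 2026-08-15T18:56:39Z · rev 4 · ledger route-AtomisticToContinuum-OneCentreSteepnessLadder
GENERATED by the gate from the ledger (D-0016/17). Provers cite these decls: `theorem foo : Summit.AtomisticToContinuum.Crystallization.Theses.OneCentreSteepnessLadder.<Decl> := …` in Summits/AtomisticToContinuum/Crystallization/Theorems/<Name>.lean.
-/

namespace Summit.AtomisticToContinuum.Crystallization.Theses.OneCentreSteepnessLadder

open scoped BigOperators Topology Manifold Classical MeasureTheory ProbabilityTheory Matrix InnerProductSpace ComplexConjugate ContinuousMap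
open Filter Set Function TopologicalSpace MeasureTheory

attribute [summit_statement] _root_.Crystallization

/-- item stmt-AtomisticToContinuum-12882 · crux (kind.auto-crux: conjecture-grade) · rank 0 · open · by planner
why it might fail: q = 6 is not steep: icosahedral/Frank–Kasper and mildly crammed centres beat close-packed first shells by 4–8 % and the r⁻⁶ tail decouples only geometrically, so no finite-range LOCAL rule may collect enough nearby deficit (bare r⁻⁶ sums: Mackay 14.7 > hcp 14.455).
sources: FlatleyTheil2015, BlancLewin2015, Stillinger2001, Blanc2004, Xue1997, HalesDSP2012
[target] X as in § Thesis, at q = 6 over `lennardJones`: ∃ δ a h with 0 < δ, 0 < a, 0 < h, 2a < 3h,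
6h < 5a, all LJ ground states δ-separated, and coercive one-centre domination with one local
antisymmetric finite-range transfer against the hcp(a,h) site value Σ'_{p ∈ hcpStacking a h}
φ₆(‖p‖), gain γ(η) at every centre whose closed 5a/3-neighbourhood is not η-matched to hcp(a,h)
(card item S4 at q = 6; the non-coercive part says every finite δ-separated cluster has truncated
energy per particle ≥ e_hcp − ε with a LOCAL certificate). -/
@[route_item "route-AtomisticToContinuum-OneCentreSteepnessLadder", crux]
def OneCentreDominationLJ : Prop :=
  ∃ δ a h : ℝ, 0 < δ ∧ 0 < a ∧ 0 < h ∧ 2 * a < 3 * h ∧ 6 * h < 5 * a ∧ (∀ (N : ℕ) (x : Fin N → EuclideanSpace ℝ (Fin 3)), Literature.MathematicalPhysics.StatisticalMechanics.IsGroundState Literature.MathematicalPhysics.StatisticalMechanics.lennardJones x → ∀ i j : Fin N, i ≠ j → δ ≤ dist (x i) (x j)) ∧ (∀ η : ℝ, 0 < η → ∃ γ : ℝ, 0 < γ ∧ ∀ ε : ℝ, 0 < ε → ∀ R₀ : ℝ, ∃ R : ℝ, R₀ ≤ R ∧ ∃ g : EuclideanSpace ℝ (Fin 3) → Set (EuclideanSpace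 ℝ (Fin 3)) → ℝ, (∀ (v : EuclideanSpace ℝ (Fin 3)) (U : Set (EuclideanSpace ℝ (Fin 3))), R < ‖v‖ → g v U = 0) ∧ ∀ S : Set (EuclideanSpace ℝ (Fin 3)), (∀ x ∈ S, ∀ y ∈ S, x ≠ y → δ ≤ dist x y) → (∀ x ∈ S, ∀ y ∈ S, g (y - x) (((fun z : EuclideanSpace ℝ (Fin 3) => z - x) '' S) ∩ Metric.closedBall (0 : EuclideanSpace ℝ (Fin 3)) R) = - g (x - y) (((fun z : EuclideanSpace ℝ (Fin 3) => z - y) '' S) ∩ Metric.closedBall (0 : EuclideanSpace ℝ (Fin 3)) R)) ∧ ∀ x ∈ S, ((∑' y : ↥S, (if dist x (y : EuclideanSpace ℝ (Fin 3)) ≤ R then (2 * (dist x (y : EuclideanSpace ℝ (Fin 3)))⁻¹ ^ 6 - (dist x (y : EuclideanSpace ℝ (Fin 3)))⁻¹ ^ (2 * 6)) else 0)) + (∑' y : ↥S, g ((y : EuclideanSpace ℝ (Fin 3)) - x) (((fun z : EuclideanSpace ℝ (Fin 3) => z - x) '' S) ∩ Metric.closedBall (0 : EuclideanSpace ℝ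 (Fin 3)) R)) ≤ (∑' p : ↥(Literature.MathematicalPhysics.StatisticalMechanics.hcpStacking a h), (2 * (‖(p : EuclideanSpace ℝ (Fin 3))‖)⁻¹ ^ 6 - (‖(p : EuclideanSpace ℝ (Fin 3))‖)⁻¹ ^ (2 * 6))) + ε) ∧ (¬ (∃ A : EuclideanSpace ℝ (Fin 3) →ₗᵢ[ℝ] EuclideanSpace ℝ (Fin 3), (∀ p ∈ Literature.MathematicalPhysics.StatisticalMechanics.hcpStacking a h, ‖p‖ ≤ 5 / 3 * a → ∃ y ∈ S, dist y (x + A p) ≤ η) ∧ (∀ y ∈ S, dist y x ≤ 5 / 3 * a → ∃ p ∈ Literature.MathematicalPhysics.StatisticalMechanics.hcpStacking a h, dist y (x + A p) ≤ η)) → (∑' y : ↥S, (if dist x (y : EuclideanSpace ℝ (Fin 3)) ≤ R then (2 * (dist x (y : EuclideanSpace ℝ (Fin 3)))⁻¹ ^ 6 - (dist x (y : EuclideanSpace ℝ (Fin 3)))⁻¹ ^ (2 * 6)) else 0)) + (∑' y : ↥S, g ((y : EuclideanSpace ℝ (Fin 3)) - x) (((fun z : EuclideanSpace ℝ (Fin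 3) => z - x) '' S) ∩ Metric.closedBall (0 : EuclideanSpace ℝ (Fin 3)) R)) ≤ (∑' p : ↥(Literature.MathematicalPhysics.StatisticalMechanics.hcpStacking a h), (2 * (‖(p : EuclideanSpace ℝ (Fin 3))‖)⁻¹ ^ 6 - (‖(p : EuclideanSpace ℝ (Fin 3))‖)⁻¹ ^ (2 * 6))) + ε - γ))

/-- item stmt-AtomisticToContinuum-12883 · crux · rank 2 · open · by planner
why it might fail: True in print (Hales 2012 via Flyspeck L12 + hypermap classification); the risk is formal SIZE: both inputs are computer-assisted and unproved in the tree (XL), so the crux may starve the ladder; no L12-free proof using completeness of the kissers is known (Flatley–Theil Conj. 2.2 territory).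
sources: Hales2012, HalesFlyspeck2012, HalesDSP2012, FlatleyTheil2015, KusnerKusnerLagariasShlosman2018, Musin2005
[crux] LOCAL FEJES TÓTH AT η = 0 (the unproved geometric input of the engine, filed first by the
plancard rule): if S ⊂ ℝ³ has pairwise distances ≥ 1, x ∈ S, and x as well as every point of S at
distance ≤ 1 from x has at least twelve points of S at distance exactly 1, then the twelve-shell {v
: x + v ∈ S, ‖v‖ = 1} is the image of `fccKissingPattern` (cuboctahedron) or `hcpKissingPattern`
(anticuboctahedron) under a linear isometry. In print: Flyspeck L12 at x and at each kisser gives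
Hales's class 𝒱 (shell points pairwise at 1 or ≥ 1.26), then Hales2012 Thm 3 + Lemmas 9–10 (tree:
`flyspeck_L12`, `Hales2012_contactGraphTame` UNPROVED named facts ⇒
`Hales2012_kissingConfigCongruent`; Lemma 10 and the Lemma-9 LPs are proved in tree) — restated here
so that no unproved fact enters the route's cone. Used with compactness only (q₀ free): complete =
twelve bonds in [1 − 2/q, 1 + 5.3/q]. [difficulty: XL] -/
@[route_item "route-AtomisticToContinuum-OneCentreSteepnessLadder", crux]
def LocalTwelveRigidity : Prop :=
  ∀ S : Set (EuclideanSpace ℝ (Fin 3)), (∀ x ∈ S, ∀ y ∈ S, x ≠ y → 1 ≤ dist x y) → ∀ x ∈ S, (∀ y ∈ S, dist x y ≤ 1 → 12 ≤ Set.ncard {z : EuclideanSpace ℝ (Fin 3) | z ∈ S ∧ dist y z = 1}) → ∃ A : EuclideanSpace ℝ (Fin 3) →ₗᵢ[ℝ] EuclideanSpace ℝ (Fin 3), {v : EuclideanSpace ℝ (Fin 3) | x + v ∈ S ∧ ‖v‖ = 1} = A '' (↑Literature.Geometry.DiscreteGeometry.fccKissingPattern : Set (EuclideanSpace ℝ (Fin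 3))) ∨ {v : EuclideanSpace ℝ (Fin 3) | x + v ∈ S ∧ ‖v‖ = 1} = A '' (↑Literature.Geometry.DiscreteGeometry.hcpKissingPattern : Set (EuclideanSpace ℝ (Fin 3)))

/-- item stmt-AtomisticToContinuum-12884 · crux · rank 3 · open · by planner
why it might fail: A (1−2/q)-separated environment (crammed, deep-hole, Frank–Kasper) may carry surplus whose compensating deficit lies beyond every fixed range R; hcp must be the pointwise max among Barlow sites at all orders (leading order needs q ≥ 19); the near field needs a positive localised phonon form.
sources: FlatleyTheil2015, Theil2006, HeitmannRadin1980, HalesDSP2012, Hales2012, MusinTarasov2012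
[crux] THE LADDER ENGINE (card (OC_q), truncated + coercive + one local transfer): ∃ q₀ ∀ q ≥ q₀ ∃
(a,h) with 2/3 < h/a < 5/6 (the Φ-maximising relaxed hcp scale) such that ∀η ∃γ ∀ε ∀R₀ ∃R ≥ R₀ ∃ a
range-R rule g (g v U = 0 for ‖v‖ > R; antisymmetric on every admissible S): for every (1 −
2/q)-separated S ⊂ ℝ³ and x ∈ S, Σ_{y∈S, |y−x|≤R} φ_q(|y−x|) + T_g(x) ≤ Φ_hcp(q,a,h) + ε, and ≤
Φ_hcp + ε − γ when the closed 5a/3-neighbourhood of x is not η-hcp(a,h)-matched. Proof plan, shell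
by shell: first shell ≤ 12 bonds by the PROVED kissing number + compactness (a missing/stretched
bond costs O(1)); complete neighbourhoods of radius 1 have fcc/hcp shells by LocalTwelveRigidity +
compactness, hence exactly six octahedral sites at √2·a and no deeper site; every surplus of a
complete centre near an incomplete atom (extra or deep holes: ≤ 6·φ_q(1.085) by Tammes-13
compactness) is paid by a fixed fraction of that atom's O(1) deficit through g (range 2, ≤ C
claimants); third shell: the axial pair at 2h beats the three √3-type sites of a c-aligned side for
q ≥ 19 (Flatley–Theil's selector sign read at η = 0), so hcp is the pointwise maximum among locally
Barlow centres; near the equality case th -/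
@[route_item "route-AtomisticToContinuum-OneCentreSteepnessLadder", crux]
def LadderDomination : Prop :=
  ∃ q₀ : ℕ, ∀ q : ℕ, q₀ ≤ q → ∃ a h : ℝ, 0 < a ∧ 0 < h ∧ 2 * a < 3 * h ∧ 6 * h < 5 * a ∧ (∀ η : ℝ, 0 < η → ∃ γ : ℝ, 0 < γ ∧ ∀ ε : ℝ, 0 < ε → ∀ R₀ : ℝ, ∃ R : ℝ, R₀ ≤ R ∧ ∃ g : EuclideanSpace ℝ (Fin 3) → Set (EuclideanSpace ℝ (Fin 3)) → ℝ, (∀ (v : EuclideanSpace ℝ (Fin 3)) (U : Set (EuclideanSpace ℝ (Fin 3))), R < ‖v‖ → g v U = 0) ∧ ∀ S : Set (EuclideanSpace ℝ (Fin 3)), (∀ x ∈ S, ∀ y ∈ S, x ≠ y → (1 - 2 / (q : ℝ)) ≤ dist x y) → (∀ x ∈ S, ∀ y ∈ S, g (y - x) (((fun z : EuclideanSpace ℝ (Fin 3) => z - x) '' S) ∩ Metric.closedBall (0 : EuclideanSpace ℝ (Fin 3)) R) = - g (x - y) (((fun z : EuclideanSpace ℝ (Fin 3) => z - y) '' S)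 ∩ Metric.closedBall (0 : EuclideanSpace ℝ (Fin 3)) R)) ∧ ∀ x ∈ S, ((∑' y : ↥S, (if dist x (y : EuclideanSpace ℝ (Fin 3)) ≤ R then (2 * (dist x (y : EuclideanSpace ℝ (Fin 3)))⁻¹ ^ q - (dist x (y : EuclideanSpace ℝ (Fin 3)))⁻¹ ^ (2 * q)) else 0)) + (∑' y : ↥S, g ((y : EuclideanSpace ℝ (Fin 3)) - x) (((fun z : EuclideanSpace ℝ (Fin 3) => z - x) '' S) ∩ Metric.closedBall (0 : EuclideanSpace ℝ (Fin 3)) R)) ≤ (∑' p : ↥(Literature.MathematicalPhysics.StatisticalMechanics.hcpStacking a h), (2 * (‖(p : EuclideanSpace ℝ (Fin 3))‖)⁻¹ ^ q - (‖(p : EuclideanSpace ℝ (Fin 3))‖)⁻¹ ^ (2 * q))) + ε) ∧ (¬ (∃ A : EuclideanSpace ℝ (Fin 3) →ₗᵢ[ℝ] EuclideanSpace ℝ (Fin 3), (∀ p ∈ Literature.MathematicalPhysics.StatisticalMechanics.hcpStacking a h, ‖p‖ ≤ 5 / 3 * a → ∃ y ∈ S, dist y (x + A p) ≤ η) ∧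 (∀ y ∈ S, dist y x ≤ 5 / 3 * a → ∃ p ∈ Literature.MathematicalPhysics.StatisticalMechanics.hcpStacking a h, dist y (x + A p) ≤ η)) → (∑' y : ↥S, (if dist x (y : EuclideanSpace ℝ (Fin 3)) ≤ R then (2 * (dist x (y : EuclideanSpace ℝ (Fin 3)))⁻¹ ^ q - (dist x (y : EuclideanSpace ℝ (Fin 3)))⁻¹ ^ (2 * q)) else 0)) + (∑' y : ↥S, g ((y : EuclideanSpace ℝ (Fin 3)) - x) (((fun z : EuclideanSpace ℝ (Fin 3) => z - x) '' S) ∩ Metric.closedBall (0 : EuclideanSpace ℝ (Fin 3)) R)) ≤ (∑' p : ↥(Literature.MathematicalPhysics.StatisticalMechanics.hcpStacking a h), (2 * (‖(p : EuclideanSpace ℝ (Fin 3))‖)⁻¹ ^ q - (‖(p : EuclideanSpace ℝ (Fin 3))‖)⁻¹ ^ (2 * q))) + ε - γ))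

/-- item stmt-AtomisticToContinuum-12885 · crux · rank 4 · open · by planner
why it might fail: Two-way closed-ball matching must pass to exact environments under local limits, and relaxed-hcp rigidity from 5a/3-environments must hold for all h/a in (2/3, 5/6) incl. the ideal case; a non-periodic δ-separated set with all 5a/3-environments hcp(a,h)-isometric would refute it (none expected).
sources: Radin1991, BlancLewin2015, HalesDSP2012, LucaFriesecke2016
[crux] HULL EXACTIFICATION on the ladder (card item S5 = card hull-exactification-cascade H1, typed
so that no Hales-2012 fact is needed): for q ≥ 4, δ, a, h > 0 with 2a < 3h and 6h < 5a, if all V_q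
ground states are δ-separated and, for EVERY η > 0, the fraction of particles whose closed
(5a/3)-neighbourhood is not η-matched (both ways, up to a linear isometry) to the hcp(a,h) site
environment tends to 0 along every ground-state sequence, then IsCrystallizing (miePotential q) 3.
Plan (soft, no energy): δ-separation ⇒ ≤ C R³ particles per R-ball ⇒ by double counting some
particle has no η_k-defect within R_k; translate it to 0; local compactness of δ-separated sets,
compactness of O(3) and η_k → 0 give along a diagonal subsequence a local limit S∞ ∋ 0 every point
of which has its open 5a/3-environment EXACTLY isometric to hcp(a,h)'s (20 sites: hexagon at a, 3+3
at √(a²/3+h²), 3+3 at √(4a²/3+h²), axial pair at 2h — the window keeps exactly these inside 5a/3);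
local-to-global rigidity: common-neighbour pairs force one hexagon plane per layer, the ρ₁-sextets
force parallel layers at spacing h over holes, the axial pair forces ABAB (ideal h/a = √(2/3):
anticuboctahedra, tree `HalesDSP_ -/
@[route_item "route-AtomisticToContinuum-OneCentreSteepnessLadder", crux]
def ExactificationCascade : Prop :=
  ∀ q : ℕ, 4 ≤ q → ∀ δ a h : ℝ, 0 < δ → 0 < a → 0 < h → 2 * a < 3 * h → 6 * h < 5 * a → (∀ (N : ℕ) (x : Fin N → EuclideanSpace ℝ (Fin 3)), Literature.MathematicalPhysics.StatisticalMechanics.IsGroundState (Literature.MathematicalPhysics.StatisticalMechanics.miePotential q) x → ∀ i j : Fin N, i ≠ j → δ ≤ dist (x i) (x j)) → (∀ η : ℝ, 0 < η → ∀ x : (N : ℕ) → (Fin N → EuclideanSpace ℝ (Fin 3)), (∀ N, Literature.MathematicalPhysics.StatisticalMechanics.IsGroundState (Literature.MathematicalPhysics.StatisticalMechanics.miePotential q) (x N)) → Filter.Tendsto (fun N : ℕ => (Nat.card {i : Fin N // ¬ (∃ A : EuclideanSpace ℝ (Fin 3) →ₗᵢ[ℝ] EuclideanSpace ℝ (Fin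 3), (∀ p ∈ Literature.MathematicalPhysics.StatisticalMechanics.hcpStacking a h, ‖p‖ ≤ 5 / 3 * a → ∃ j : Fin N, dist (x N j) (x N i + A p) ≤ η) ∧ (∀ j : Fin N, dist (x N j) (x N i) ≤ 5 / 3 * a → ∃ p ∈ Literature.MathematicalPhysics.StatisticalMechanics.hcpStacking a h, dist (x N j) (x N i + A p) ≤ η))} : ℝ) / N) Filter.atTop (nhds 0)) → Literature.MathematicalPhysics.StatisticalMechanics.IsCrystallizing (Literature.MathematicalPhysics.StatisticalMechanics.miePotential q) 3

/-- item stmt-AtomisticToContinuum-14452 · crux · rank 5 · open · by planner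
why it might fail: q = 6 is not steep: ico/Frank–Kasper and 13–14-fold centres (bonds in [0.93,1.05]) come within 4–8 % in the first shell, a third of Φ_hcp = 17.22 lies beyond it, and hcp beats fcc by only 2e-3 (1e-4·Φ), so γ(η) ≤ 2e-3 and no finite-range rule may localise the compensating deficit.
sources: FlatleyTheil2015, BlancLewin2015, HalesDSP2012, Hales2012, Stillinger2001, Yuhjtman2015
[crux] COERCIVE ONE-CENTRE DOMINATION AT EXPONENT 6 OVER (2/3)-SEPARATED POINT SETS — the geometric
core of X and literally the matrix of LadderDomination at q = 6 (1 − 2/6 = 2/3;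
`ladder_at_six_gives_crux` in the planner's Sketch.lean rewrites one into the other): there is an
hcp scale (a,h) with 2a < 3h, 6h < 5a such that ∀η ∃γ > 0 ∀ε ∀R₀ ∃R ≥ R₀ ∃ a range-R rule g (g v U =
0 for ‖v‖ > R), antisymmetric on every (2/3)-separated S ⊂ ℝ³, with Σ_{y∈S, |y−x|≤R} φ₆(|y−x|) +
T_g(x) ≤ Φ_hcp(a,h) + ε at every x ∈ S, and ≤ Φ_hcp(a,h) + ε − γ whenever the closed
5a/3-neighbourhood of x is not η-matched (both ways, up to a linear isometry) to hcp(a,h); φ₆(r) =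
2r⁻⁶ − r⁻¹² = −12·lennardJones r, Φ_hcp(a,h) = Σ'_{p ∈ hcpStacking a h} φ₆(‖p‖). No ground states
enter: LJ ground states are 0.684-separated by the PROVED `Yuhjtman2015_minDistance_holds` (> 2/3),
so TargetAssembly turns this crux alone into X with δ = 2/3. Stronger than X only by admitting
contacts in [2/3, d_LJ): contacts below 2^(−1/6) = 0.891 carry φ₆ < 0 (φ₆(0.85) = −1.7, φ₆(0.8) =
−6.9, φ₆(2/3) = −107) and finance their own neighbourhoods through g; the live regime — mildly
crammed bonds in [0.89, 1.05], 13–14-fold and icosahed -/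
@[route_item "route-AtomisticToContinuum-OneCentreSteepnessLadder", crux]
def LJDominationTwoThirds : Prop :=
  ∃ a h : ℝ, 0 < a ∧ 0 < h ∧ 2 * a < 3 * h ∧ 6 * h < 5 * a ∧ (∀ η : ℝ, 0 < η → ∃ γ : ℝ, 0 < γ ∧ ∀ ε : ℝ, 0 < ε → ∀ R₀ : ℝ, ∃ R : ℝ, R₀ ≤ R ∧ ∃ g : EuclideanSpace ℝ (Fin 3) → Set (EuclideanSpace ℝ (Fin 3)) → ℝ, (∀ (v : EuclideanSpace ℝ (Fin 3)) (U : Set (EuclideanSpace ℝ (Fin 3))), R < ‖v‖ → g v U = 0) ∧ ∀ S : Set (EuclideanSpace ℝ (Fin 3)), (∀ x ∈ S, ∀ y ∈ S, x ≠ y → 2 / 3 ≤ dist x y) → (∀ x ∈ S, ∀ y ∈ S, g (y - x) (((fun z : EuclideanSpace ℝ (Fin 3) => z - x) '' S) ∩ Metric.closedBall (0 : EuclideanSpace ℝ (Fin 3)) R) = - g (x - y) (((fun z : EuclideanSpace ℝ (Fin 3) => z - y) '' S) ∩ Metric.closedBall (0 : EuclideanSpace ℝ (Fin 3)) R)) ∧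 ∀ x ∈ S, ((∑' y : ↥S, (if dist x (y : EuclideanSpace ℝ (Fin 3)) ≤ R then (2 * (dist x (y : EuclideanSpace ℝ (Fin 3)))⁻¹ ^ 6 - (dist x (y : EuclideanSpace ℝ (Fin 3)))⁻¹ ^ (2 * 6)) else 0)) + (∑' y : ↥S, g ((y : EuclideanSpace ℝ (Fin 3)) - x) (((fun z : EuclideanSpace ℝ (Fin 3) => z - x) '' S) ∩ Metric.closedBall (0 : EuclideanSpace ℝ (Fin 3)) R)) ≤ (∑' p : ↥(Literature.MathematicalPhysics.StatisticalMechanics.hcpStacking a h), (2 * (‖(p : EuclideanSpace ℝ (Fin 3))‖)⁻¹ ^ 6 - (‖(p : EuclideanSpace ℝ (Fin 3))‖)⁻¹ ^ (2 * 6))) + ε) ∧ (¬ (∃ A : EuclideanSpace ℝ (Fin 3) →ₗᵢ[ℝ] EuclideanSpace ℝ (Fin 3), (∀ p ∈ Literature.MathematicalPhysics.StatisticalMechanics.hcpStacking a h, ‖p‖ ≤ 5 / 3 * a → ∃ y ∈ S, dist y (x + A p) ≤ η) ∧ (∀ y ∈ S, dist y x ≤ 5 / 3 * a → ∃ p ∈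 Literature.MathematicalPhysics.StatisticalMechanics.hcpStacking a h, dist y (x + A p) ≤ η)) → (∑' y : ↥S, (if dist x (y : EuclideanSpace ℝ (Fin 3)) ≤ R then (2 * (dist x (y : EuclideanSpace ℝ (Fin 3)))⁻¹ ^ 6 - (dist x (y : EuclideanSpace ℝ (Fin 3)))⁻¹ ^ (2 * 6)) else 0)) + (∑' y : ↥S, g ((y : EuclideanSpace ℝ (Fin 3)) - x) (((fun z : EuclideanSpace ℝ (Fin 3) => z - x) '' S) ∩ Metric.closedBall (0 : EuclideanSpace ℝ (Fin 3)) R)) ≤ (∑' p : ↥(Literature.MathematicalPhysics.StatisticalMechanics.hcpStacking a h), (2 * (‖(p : EuclideanSpace ℝ (Fin 3))‖)⁻¹ ^ 6 - (‖(p : EuclideanSpace ℝ (Fin 3))‖)⁻¹ ^ (2 * 6))) + ε - γ))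

/-- item stmt-AtomisticToContinuum-10945 · support · rank 9 · closed · proved by Summit.AtomisticToContinuum.Crystallization.Theorems.LadderGroundStates_proof @ f667b2aa9262 (prover) · by planner
sources: BlancLewin2015, Blanc2004, Xue1997
[support] GROUND STATES ON THE (2q,q) LADDER EXIST AND ARE (1 − 2/q)-SEPARATED for q ≥ q₀ — the
claim of item stmt-AtomisticToContinuum-3623 (and 9212) written over `miePotential q` (rev 3;
definitionally equal to the `mieWith` form): Blanc–Lewin §1.2 binding criterion as in the tree's
PROVED `LennardJonesGroundStatesExist_holds`; Xue/Blanc removal-plus-packing as in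
`LennardJonesMinimalDistance_holds` (LennardJonesClusters.lean — import it in the Theorems file; the
route file deliberately does not). RungAssembly consumes existence and separation from it.
[difficulty: M] -/
@[route_item "route-AtomisticToContinuum-OneCentreSteepnessLadder", crux]
def LadderGroundStates : Prop :=
  ∃ q₀ : ℕ, ∀ q : ℕ, q₀ ≤ q → (∀ N : ℕ, ∃ x : Fin N → EuclideanSpace ℝ (Fin 3), Literature.MathematicalPhysics.StatisticalMechanics.IsGroundState (Literature.MathematicalPhysics.StatisticalMechanics.miePotential q) x) ∧ (∀ (N : ℕ) (x : Fin N → EuclideanSpace ℝ (Fin 3)), Literature.MathematicalPhysics.StatisticalMechanics.IsGroundState (Literature.MathematicalPhysics.StatisticalMechanics.miePotential q) x → ∀ i j : Fin N, i ≠ j → (1 - 2 / (q : ℝ)) ≤ dist (x i) (x j))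

/-- `LadderGroundStates` holds: proved by `Summit.AtomisticToContinuum.Crystallization.Theorems.LadderGroundStates_proof` @ f667b2aa9262. -/
theorem LadderGroundStates_holds : LadderGroundStates := _root_.Summit.AtomisticToContinuum.Crystallization.Theorems.LadderGroundStates_proof

/-- item stmt-AtomisticToContinuum-10946 · support · rank 9 · open · by planner
sources: FlatleyTheil2015, Theil2006, ELi2008, BeterminSamajTravenec2022, BlancLewin2015, arXiv:2604.19239
[support] THE BRITTLE RUNG (milestone; card headline; the claim of item
stmt-AtomisticToContinuum-3624 (and 9213) written over `miePotential q`, rev 3): there is q₀ such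
that for all q ≥ q₀, HasPeriodicGroundStateEnergy V_q 3 ∧ IsCrystallizing V_q 3 — both Blanc–Lewin
conjuncts for the Mie (2q,q) potential in ℝ³, Flatley–Theil without V₃ (conclusion relaxed hcp).
Closed here by RungAssembly; a hypothesis of `closes` like every item, but not used by its proof.
[difficulty: open-problem] -/
@[route_item "route-AtomisticToContinuum-OneCentreSteepnessLadder", crux]
def MieRung : Prop :=
  ∃ q₀ : ℕ, ∀ q : ℕ, q₀ ≤ q → Literature.MathematicalPhysics.StatisticalMechanics.HasPeriodicGroundStateEnergy (Literature.MathematicalPhysics.StatisticalMechanics.miePotential q) 3 ∧ Literature.MathematicalPhysics.StatisticalMechanics.IsCrystallizing (Literature.MathematicalPhysics.StatisticalMechanics.miePotential q) 3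

/-- item stmt-AtomisticToContinuum-12886 · support · rank 9 · closed · proved by Summit.AtomisticToContinuum.Crystallization.Theorems.oneCentreSteepnessLadder_zeroDensityOfDefects @ 3840c8a67456 (prover) · by planner
sources: Theil2006, LucaFriesecke2016, BlancLewin2015
[support] ZERO DENSITY OF DEFECTIVE CENTRES from coercive domination (glue X / LadderDomination →
ExactificationCascade): for q ≥ 4, δ, a, h > 0, δ-separated ground states + coercive domination at
(q, δ, a, h) ⇒ for every η the fraction of η-defective centres → 0 along every ground-state
sequence. Bookkeeping: E = −(1/(4q)) Σ_i Φ(x_i); Σ_i T_g(x_i) = 0 (antisymmetry, finite S); 0 ≤ Φ −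
Φ^{≤R} ≤ ε_R(δ, q) → 0 (shell counting, q > 3, φ_q > 0 beyond R ≥ 1); trial upper bound E(N) ≤ −N
Φ_hcp(a,h)/(4q) + o(N) by finite blocks of hcpStacking a h (V_q ≥ −1/(2q),
`groundStateEnergy_le_of_le`); hence γ(η)·#defective ≤ N(ε + ε_R) + o(N) with ε, R free after γ.
[difficulty: M] -/
@[route_item "route-AtomisticToContinuum-OneCentreSteepnessLadder", crux]
def ZeroDensityOfDefects : Prop :=
  ∀ q : ℕ, 4 ≤ q → ∀ δ a h : ℝ, 0 < δ → 0 < a → 0 < h → (∀ (N : ℕ) (x : Fin N → EuclideanSpace ℝ (Fin 3)), Literature.MathematicalPhysics.StatisticalMechanics.IsGroundState (Literature.MathematicalPhysics.StatisticalMechanics.miePotential q) x → ∀ i j : Fin N, i ≠ j → δ ≤ dist (x i) (x j)) → (∀ η : ℝ, 0 < η → ∃ γ : ℝ, 0 < γ ∧ ∀ ε : ℝ, 0 < ε → ∀ R₀ : ℝ, ∃ R : ℝ, R₀ ≤ R ∧ ∃ g : EuclideanSpace ℝ (Fin 3) → Set (EuclideanSpace ℝ (Fin 3)) → ℝ, (∀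 (v : EuclideanSpace ℝ (Fin 3)) (U : Set (EuclideanSpace ℝ (Fin 3))), R < ‖v‖ → g v U = 0) ∧ ∀ S : Set (EuclideanSpace ℝ (Fin 3)), (∀ x ∈ S, ∀ y ∈ S, x ≠ y → δ ≤ dist x y) → (∀ x ∈ S, ∀ y ∈ S, g (y - x) (((fun z : EuclideanSpace ℝ (Fin 3) => z - x) '' S) ∩ Metric.closedBall (0 : EuclideanSpace ℝ (Fin 3)) R) = - g (x - y) (((fun z : EuclideanSpace ℝ (Fin 3) => z - y) '' S) ∩ Metric.closedBall (0 : EuclideanSpace ℝ (Fin 3)) R)) ∧ ∀ x ∈ S, ((∑' y : ↥S, (if dist x (y : EuclideanSpace ℝ (Fin 3)) ≤ R then (2 * (dist x (y : EuclideanSpace ℝ (Fin 3)))⁻¹ ^ q - (dist x (y : EuclideanSpace ℝ (Fin 3)))⁻¹ ^ (2 * q)) else 0)) + (∑' y : ↥S, g ((y : EuclideanSpace ℝ (Fin 3)) - x) (((fun z : EuclideanSpace ℝ (Fin 3) => z - x) '' S) ∩ Metric.closedBall (0 : EuclideanSpace ℝ (Fin 3)) R)) ≤ (∑' p : ↥(Literature.MathematicalPhysics.StatisticalMechanics.hcpStacking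 a h), (2 * (‖(p : EuclideanSpace ℝ (Fin 3))‖)⁻¹ ^ q - (‖(p : EuclideanSpace ℝ (Fin 3))‖)⁻¹ ^ (2 * q))) + ε) ∧ (¬ (∃ A : EuclideanSpace ℝ (Fin 3) →ₗᵢ[ℝ] EuclideanSpace ℝ (Fin 3), (∀ p ∈ Literature.MathematicalPhysics.StatisticalMechanics.hcpStacking a h, ‖p‖ ≤ 5 / 3 * a → ∃ y ∈ S, dist y (x + A p) ≤ η) ∧ (∀ y ∈ S, dist y x ≤ 5 / 3 * a → ∃ p ∈ Literature.MathematicalPhysics.StatisticalMechanics.hcpStacking a h, dist y (x + A p) ≤ η)) → (∑' y : ↥S, (if dist x (y : EuclideanSpace ℝ (Fin 3)) ≤ R then (2 * (dist x (y : EuclideanSpace ℝ (Fin 3)))⁻¹ ^ q - (dist x (y : EuclideanSpace ℝ (Fin 3)))⁻¹ ^ (2 * q)) else 0)) + (∑' y : ↥S, g ((y : EuclideanSpace ℝ (Fin 3)) - x) (((fun z : EuclideanSpace ℝ (Fin 3) => z - x) '' S) ∩ Metric.closedBall (0 : EuclideanSpace ℝ (Fin 3)) R)) ≤ (∑' p :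 ↥(Literature.MathematicalPhysics.StatisticalMechanics.hcpStacking a h), (2 * (‖(p : EuclideanSpace ℝ (Fin 3))‖)⁻¹ ^ q - (‖(p : EuclideanSpace ℝ (Fin 3))‖)⁻¹ ^ (2 * q))) + ε - γ)) → (∀ η : ℝ, 0 < η → ∀ x : (N : ℕ) → (Fin N → EuclideanSpace ℝ (Fin 3)), (∀ N, Literature.MathematicalPhysics.StatisticalMechanics.IsGroundState (Literature.MathematicalPhysics.StatisticalMechanics.miePotential q) (x N)) → Filter.Tendsto (fun N : ℕ => (Nat.card {i : Fin N // ¬ (∃ A : EuclideanSpace ℝ (Fin 3) →ₗᵢ[ℝ] EuclideanSpace ℝ (Fin 3), (∀ p ∈ Literature.MathematicalPhysics.StatisticalMechanics.hcpStacking a h, ‖p‖ ≤ 5 / 3 * a → ∃ j : Fin N, dist (x N j) (x N i + A p) ≤ η) ∧ (∀ j : Fin N, dist (x N j) (x N i) ≤ 5 / 3 * a → ∃ p ∈ Literature.MathematicalPhysics.StatisticalMechanics.hcpStacking a h, dist (x N j) (x N i + A p) ≤ η))} : ℝ) / N) Filter.atTop (nhds 0))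

/-- item stmt-AtomisticToContinuum-12887 · support · rank 9 · closed · proved by Summit.AtomisticToContinuum.Crystallization.Theorems.dominationEnergyLimit_proof @ 9860e8d0d157 (prover) · by planner
sources: BlancLewin2015, Theil2006
[support] ENERGETIC CONJUNCT from domination (uses only its non-coercive part; hypothesis kept
identical to ZeroDensityOfDefects so that `closes` is pure application): for q ≥ 4, δ, a, h > 0,
existence of V_q ground states for all N + δ-separation + domination at (q, δ, a, h) ⇒
HasPeriodicGroundStateEnergy (miePotential q) 3 with P = hcpPeriodicConfiguration a h. Lower bound:
transfers cancel, Φ ≤ Φ^{≤R} + ε_R ⇒ E(N)/N ≥ −(Φ_hcp + ε + ε_R)/(4q). Upper bound: E(N) ≤ N e(Q) +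
o(N) for every periodic Q by blocks (point sets of periodic configurations are uniformly discrete;
tails summable for q > 3; `PeriodicConfigurationSums`), so e(Q) ≥ lim E(N)/N = −Φ_hcp/(4q) = e(hcp a
h) (the two motif sites are equivalent; the p = 0 term of the tsum is 0) — IsLeast with an explicit
minimiser, no compactness over lattices. [difficulty: M] -/
@[route_item "route-AtomisticToContinuum-OneCentreSteepnessLadder", crux]
def DominationEnergyLimit : Prop :=
  ∀ q : ℕ, 4 ≤ q → ∀ δ a h : ℝ, 0 < δ → 0 < a → 0 < h → (∀ N : ℕ, ∃ x : Fin N → EuclideanSpace ℝ (Fin 3), Literature.MathematicalPhysics.StatisticalMechanics.IsGroundState (Literature.MathematicalPhysics.StatisticalMechanics.miePotential q) x) → (∀ (N : ℕ) (x : Fin N → EuclideanSpace ℝ (Fin 3)), Literature.MathematicalPhysics.StatisticalMechanics.IsGroundState (Literature.MathematicalPhysics.StatisticalMechanics.miePotential q) x → ∀ i j : Fin N, i ≠ j → δ ≤ dist (x i) (x j)) → (∀ η : ℝ, 0 < η → ∃ γ : ℝ, 0 < γ ∧ ∀ ε : ℝ, 0 < ε → ∀ R₀ : ℝ, ∃ R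 : ℝ, R₀ ≤ R ∧ ∃ g : EuclideanSpace ℝ (Fin 3) → Set (EuclideanSpace ℝ (Fin 3)) → ℝ, (∀ (v : EuclideanSpace ℝ (Fin 3)) (U : Set (EuclideanSpace ℝ (Fin 3))), R < ‖v‖ → g v U = 0) ∧ ∀ S : Set (EuclideanSpace ℝ (Fin 3)), (∀ x ∈ S, ∀ y ∈ S, x ≠ y → δ ≤ dist x y) → (∀ x ∈ S, ∀ y ∈ S, g (y - x) (((fun z : EuclideanSpace ℝ (Fin 3) => z - x) '' S) ∩ Metric.closedBall (0 : EuclideanSpace ℝ (Fin 3)) R) = - g (x - y) (((fun z : EuclideanSpace ℝ (Fin 3) => z - y) '' S) ∩ Metric.closedBall (0 : EuclideanSpace ℝ (Fin 3)) R)) ∧ ∀ x ∈ S, ((∑' y : ↥S, (if dist x (y : EuclideanSpace ℝ (Fin 3)) ≤ R then (2 * (dist x (y : EuclideanSpace ℝ (Fin 3)))⁻¹ ^ q - (dist x (y : EuclideanSpace ℝ (Fin 3)))⁻¹ ^ (2 * q)) else 0)) + (∑' y : ↥S, g ((y : EuclideanSpace ℝ (Fin 3)) - x) (((fun z : EuclideanSpace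 ℝ (Fin 3) => z - x) '' S) ∩ Metric.closedBall (0 : EuclideanSpace ℝ (Fin 3)) R)) ≤ (∑' p : ↥(Literature.MathematicalPhysics.StatisticalMechanics.hcpStacking a h), (2 * (‖(p : EuclideanSpace ℝ (Fin 3))‖)⁻¹ ^ q - (‖(p : EuclideanSpace ℝ (Fin 3))‖)⁻¹ ^ (2 * q))) + ε) ∧ (¬ (∃ A : EuclideanSpace ℝ (Fin 3) →ₗᵢ[ℝ] EuclideanSpace ℝ (Fin 3), (∀ p ∈ Literature.MathematicalPhysics.StatisticalMechanics.hcpStacking a h, ‖p‖ ≤ 5 / 3 * a → ∃ y ∈ S, dist y (x + A p) ≤ η) ∧ (∀ y ∈ S, dist y x ≤ 5 / 3 * a → ∃ p ∈ Literature.MathematicalPhysics.StatisticalMechanics.hcpStacking a h, dist y (x + A p) ≤ η)) → (∑' y : ↥S, (if dist x (y : EuclideanSpace ℝ (Fin 3)) ≤ R then (2 * (dist x (y : EuclideanSpace ℝ (Fin 3)))⁻¹ ^ q - (dist x (y : EuclideanSpace ℝ (Fin 3)))⁻¹ ^ (2 * q)) else 0)) + (∑' y : ↥S, g ((y : EuclideanSpace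 ℝ (Fin 3)) - x) (((fun z : EuclideanSpace ℝ (Fin 3) => z - x) '' S) ∩ Metric.closedBall (0 : EuclideanSpace ℝ (Fin 3)) R)) ≤ (∑' p : ↥(Literature.MathematicalPhysics.StatisticalMechanics.hcpStacking a h), (2 * (‖(p : EuclideanSpace ℝ (Fin 3))‖)⁻¹ ^ q - (‖(p : EuclideanSpace ℝ (Fin 3))‖)⁻¹ ^ (2 * q))) + ε - γ)) → Literature.MathematicalPhysics.StatisticalMechanics.HasPeriodicGroundStateEnergy (Literature.MathematicalPhysics.StatisticalMechanics.miePotential q) 3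

/-- item stmt-AtomisticToContinuum-12888 · support · rank 9 · closed · proved by Summit.AtomisticToContinuum.Crystallization.Theorems.rungAssembly_proof @ a572036fb3f5 (prover) · by planner
sources: BlancLewin2015, FlatleyTheil2015
[support] GLUE FOR THE RUNG: LadderDomination → LadderGroundStates → ZeroDensityOfDefects →
ExactificationCascade → DominationEnergyLimit → MieRung (take q ≥ max(q₀, q₀', 4); δ = 1 − 2/q > 0;
pure bookkeeping). [difficulty: provable-now] -/
@[route_item "route-AtomisticToContinuum-OneCentreSteepnessLadder", crux]
def RungAssembly : Prop :=
  LadderDomination → LadderGroundStates → ZeroDensityOfDefects → ExactificationCascade → DominationEnergyLimit → MieRung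

/-- item stmt-AtomisticToContinuum-14453 · support · rank 9 · closed · proved by Summit.AtomisticToContinuum.Crystallization.Theorems.targetAssembly_proof @ 599c8893be48 (prover) · by planner
sources: Yuhjtman2015, BlancLewin2015, Blanc2004, Xue1997
[support] GLUE FOR THE TARGET (route-choice repair 2026-08-16, option (a): `Crux… →
OneCentreDominationLJ`): LJDominationTwoThirds → OneCentreDominationLJ with δ := 2/3. The separation
half of X — every Lennard-Jones ground state is (2/3)-separated — is discharged INSIDE the proof by
the PROVED Literature theorem `Yuhjtman2015_minDistance_holds` (Yuhjtman 2015, Cor. 7: all distances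
> 0.684 > 2/3; Literature/MathematicalPhysics/StatisticalMechanics/Yuhjtman2015Proofs.lean — import
it in the Theorems file, the route file does not; in print also Schachinger–Addis–Bomze–Schoen 2007,
0.67985; the tree's qualitative `LennardJonesMinimalDistance_holds`, δ = 1/3, is too weak), the rest
is `⟨2/3, a, h, _, ha, hh, hw₁, hw₂, sep, hdom⟩` (`targetAssembly_holds` in the planner's
Sketch.lean, lean check rc 0, 0 sorries). Not filed as a separate separation item only because the
gate's top-level count for this route stands at 13/15 (10 visible items), so exactly two items fit.
With it the target is reachable from a crux and `closes` (rev 2, 12 hypotheses) DERIVES X as hT hD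
instead of only assuming it. [difficulty: provable-now] -/
@[route_item "route-AtomisticToContinuum-OneCentreSteepnessLadder", crux]
def TargetAssembly : Prop :=
  LJDominationTwoThirds → OneCentreDominationLJ

/-- item stmt-AtomisticToContinuum-12889 · assembly · rank 1 · closed · proved by Summit.AtomisticToContinuum.Crystallization.Theorems.oneCentreSteepnessLadder_assembly_proof @ 86c75d189fc4 (prover) · by planner
sources: BlancLewin2015, FlatleyTheil2015
[assembly] OneCentreDominationLJ → ZeroDensityOfDefects → ExactificationCascade →
DominationEnergyLimit → Crystallization (q = 6 instances of the three ∀q-lemmas; V₆ = lennardJones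
by `miePotential_six`; existence of LJ ground states is the proved Literature theorem). -/
@[route_item "route-AtomisticToContinuum-OneCentreSteepnessLadder", crux]
def Assembly : Prop :=
  OneCentreDominationLJ → ZeroDensityOfDefects → ExactificationCascade → DominationEnergyLimit → _root_.Crystallization

/-! D-0027 §2.1 — DECIDING THEOREM (planner-authored via `route open/edit --closes-file`; by planner-rchoice-AtomisticToContinuum-OneCentre-077b8449-0 2026-08-16T03:26:08Z):
its hypotheses are this route's items and its conclusion the sub-problem Statement (glue_lint), and it elaborates with this file. -/

@[closes "route-AtomisticToContinuum-OneCentreSteepnessLadder"] theorem closes : OneCentreDominationLJ → LocalTwelveRigidity → LadderDomination → ExactificationCascade → ZeroDensityOfDefects → DominationEnergyLimit → LadderGroundStates → MieRung → RungAssembly → Assembly → LJDominationTwoThirds → TargetAssembly → _root_.Crystallization := by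
  intro _hX₀ _hLoc _hLad hEx hZ hE _hGS _hRung _hRA _hA hD hT
  obtain ⟨δ, a, h, hδ, ha, hh, hw₁, hw₂, hsep, hdom⟩ := hT hD
  have hsep' : ∀ (N : ℕ) (x : Fin N → EuclideanSpace ℝ (Fin 3)),
      Literature.MathematicalPhysics.StatisticalMechanics.IsGroundState
        (Literature.MathematicalPhysics.StatisticalMechanics.miePotential 6) x →
      ∀ i j : Fin N, i ≠ j → δ ≤ dist (x i) (x j) := by
    rw [Literature.MathematicalPhysics.StatisticalMechanics.miePotential_six]; exact hsep
  have hex : ∀ N : ℕ, ∃ x : Fin N → EuclideanSpace ℝ (Fin 3),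
      Literature.MathematicalPhysics.StatisticalMechanics.IsGroundState
        (Literature.MathematicalPhysics.StatisticalMechanics.miePotential 6) x := by
    rw [Literature.MathematicalPhysics.StatisticalMechanics.miePotential_six]
    exact Literature.MathematicalPhysics.StatisticalMechanics.LennardJonesGroundStatesExist_holds
  have h46 : (4 : ℕ) ≤ 6 := by norm_num
  have hzd := hZ 6 h46 δ a h hδ ha hh hsep' hdom
  have hcr := hEx 6 h46 δ a h hδ ha hh hw₁ hw₂ hsep' hzd
  have hen := hE 6 h46 δ a h hδ ha hh hex hsep' hdom
  rw [Literature.MathematicalPhysics.StatisticalMechanics.miePotential_six] at hcr hen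
  exact And.intro hen hcr

end Summit.AtomisticToContinuum.Crystallization.Theses.OneCentreSteepnessLadder
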